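import Literature.NumberTheory.Sieve.HeathBrownCubicFLRemaindersA
import Literature.NumberTheory.Sieve.HeathBrownCubicTypeITools
import Literature.NumberTheory.Sieve.HeathBrownCubicNormWindowSieve
import Literature.NumberTheory.Sieve.HeathBrownCubicUpperBoundProofs
import HarnessLib

/-!
# Heath-Brown's Lemma 7.1 for `𝒜^(K)`, Lemma 7.1 and Lemma 3.6, from the Type I bound Lemma 3.2

Pure-proof file (no definitions, no named facts) in the decomposition of **parity.S18** along
D. R. Heath-Brown, *Primes represented by `x³ + 2y³`*, Acta Math. 186 (2001), 1–84. With
`HeathBrownCubicNormWindowSieve` (the `ℬ^(K)`-half of Lemma 7.1, proved outright) it closes the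
upper-bound sieve Lemma 7.1 (p. 39) and hence Lemma 3.6 (p. 14) up to the Type I bound Lemma 3.2:

* `HeathBrown2001_lemma_7_1_A_of_typeI_A` — the `𝒜^(K)`-half of the corrected Lemma 7.1
  (`HeathBrown2001_lemma_7_1_normWeighted`, first conjunct) from `HeathBrown2001_typeI_A`;
* `HeathBrown2001_lemma_7_1_normWeighted_of_typeI_A :
    HeathBrown2001_typeI_A → HeathBrown2001_lemma_7_1_normWeighted`;
* `HeathBrown2001_lemma_3_6_of_typeI_A : HeathBrown2001_typeI_A → HeathBrown2001_lemma_3_6`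
  (through the tree's `HeathBrown2001_lemma_3_6_of_lemma_7_1`).

So in the frontier of parity.S18 the named facts Lemma 3.6 and Lemma 7.1 are replaced by Lemma 3.2
(`HeathBrown2001_typeI_A`, `HeathBrownCubicSieveSetup`), the level of distribution `X^{2−ε}` of the
binary cubic form, on which Lemma 3.5 and Lemma 3.7 also rest; once it is proved,
`HeathBrown2001_lemma_3_6_holds` is `HeathBrown2001_lemma_3_6_of_typeI_A` applied to it.

## The argument (pp. 40–41, for `𝒜`)

For `Q` ranging over the ideals with `N(Q) = q ∈ 𝒬` (`q` square-free in `(N, 2N]`), `z ≥ X^τ`,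
`N ≤ X^{2−2τ}`, put `z₁ = min(z, X^{2−τ}/N) ≥ X^τ`, `z₂ = z₁^{1/28}`, `D = z₁`.
1. (`siftedA_eq_zero_of_prime_dvd`, p. 40: "Clearly we may suppose that every prime factor `p` of
   an element `q ∈ 𝒬` satisfies `p ≥ z`".) If `q` has a prime factor `< z₂ ≤ z`, a prime ideal of that
   norm divides every `Q` of norm `q` (Lemma 3.1 for ideals of square-free norm,
   `normSimple_of_squarefree_absNorm`), so all `S_K(𝒜^(K)_Q, z)` vanish.
2. (`sum_normEq_siftedA_le_sifted_seqA`, (6.2).) Otherwise `∑_{N(Q)=q} S_K(𝒜^(K)_Q, z) ≤ S(𝒜_q, P(z₂))`,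
   the sifted sum of the rational sequence `𝒜_q` of `HeathBrownCubicFLSequencesA` (`seqA`): a pair
   with `Q ∣ (x + yθ)` and no prime ideal factor of norm `< z` has `q ∣ x³ + 2y³` coprime to `P(z₂)`
   (`NormSimple.isRough_iff_coprime`), and is divisible by at most one ideal of norm `q`
   (`NormSimple.eq_prod_filter_of_dvd`).
3. (`sum_normEq_siftedA_le_main_add_err`.) The beta-sieve upper bound of the tree
   (`SieveSequence.sifted_le_of_dvd_primesProdBelow`, dimension `3`, `hasSieveDimension_densA`,
   level `D = z₂^{28}`) gives `S(𝒜_q, P(z₂)) ≤ (1 + 2K₃^{10}) X_𝒜 (ρ₀(q)/q) V(z₂) + ∑_{d ≤ D} |R_d(𝒜_q)|`,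
   where `V(z₂) ≤ K_V/log z₂` (`exists_prod_one_sub_densA_le`: Mertens for the degree-one primes of
   `K`, i.e. (6.9)), `ρ₀(q)/q ≤ c_K(q)/q = ∑_{N(Q)=q} N(Q)^{-1}` (`densA_le_card_normEq_div` — the
   ideal weight of the corrected lemma), and `|R_d(𝒜_q)| ≤ ∑_{N(R)=qd} |#𝒜^(K)_R − X_𝒜ρ₂(R)/N(R)|`
   (`abs_remainder_seqA_le`, p. 35).
4. (`remainder_collection_le`, `exists_typeI_dyadic`, `abs_card_boxPairs_sub_sizeA_le`,
   `remainders_absorb_le`.) The ideals of norm `qd` are distinct for distinct `(q, d)` and have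
   square-free norm `≤ 2X^{2−τ}`; their Type I errors total `|#𝒜^(K) − X_𝒜| ≪ X log X`
   (`exists_abs_countA_one_sub_sizeA_le` of `HeathBrownCubicFLRemaindersA`) plus the dyadic sum of
   Lemma 3.2,
   `≪ (B + X√B + X^{3/2})(log X)^{k+1}` with `B = 2X^{2−τ}`, together `≤ X^{2−τ/5}` for large `X`
   ((2.5): `τ log X → ∞`; `eventually_upperBound_params`).

## References

* D. R. Heath-Brown, *Primes represented by `x³ + 2y³`*, Acta Math. 186 (2001), 1–84: Lemma 7.1
  (p. 39) and its proof (pp. 40–41); Lemma 3.1 (p. 11), (6.2) (p. 34), p. 35; Lemma 3.6 (p. 14).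
  [cite: HeathBrownActa2001, Lemma 7.1]
* G. Greaves, *Sieves in Number Theory*, Springer (2001), Thm 3.3.1 (the upper-bound sieve used,
  through `SieveFrameworkUpperBound`). [cite: Greaves2001, §3.3.4 Thm 1]

## Mathlib / tree search

Mathlib: `Finset.card_biUnion`, `Finset.sum_biUnion`, `Finset.sum_fiberwise_of_maps_to`,
`Nat.Coprime.gcd_mul_left_cancel`, `Nat.squarefree_mul`, `Nat.Prime.not_coprime_iff_dvd`,
`isLittleO_log_rpow_atTop`, `Real.rpow_le_rpow_of_exponent_le`. Tree: `HeathBrownCubicFLSequencesA`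
(`seqA`, `sifted_seqA_eq`, `abs_remainder_seqA_le`, `hasSieveDimension_densA`, `NormSimple`, `normEq`,
`densA`, `sizeA`, `topA`), `HeathBrownCubicFLRemaindersA` (`exists_abs_countA_one_sub_sizeA_le`, the
coprime pairs of the box), `HeathBrownCubicTypeITools` (`one_le_idealDivisorCount`), `HeathBrownCubicNormWindowSieve` (`HeathBrown2001_lemma_7_1_B`,
`eventually_params_B`), `HeathBrownCubicUpperBoundProofs` (`HeathBrown2001_lemma_3_6_of_lemma_7_1`),
`HeathBrownCubicUpperBoundTools` (`dyadIdx`, `eventually_upperBound_params`, `sum_inv_le_one_add_log`),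
`HeathBrownCubicUpperBound` (`HeathBrown2001_lemma_7_1_normWeighted`, `normIn`),
`HeathBrownCubicSieveSetup` (`HeathBrown2001_typeI_A`, `siftedA`, `countA`, `rho₂`),
`SieveFrameworkProofs` (`sum_divisors_moebius_real`), `DegreeOnePrimesPNT`
(`sum_primesLE_idealNormCount_div_eq`).
-/

noncomputable section

open NumberField Finset Filter Topology
open scoped nonZeroDivisors

namespace Literature.NumberTheory.Sieve.CubicSieve

open LFunctions.CubeRootTwoField CubicPrimes
open Literature.NumberTheory.LFunctions (idealNormCount)

/-! ### The density `ρ₀(d)/d` of `𝒜`: `V(z) ≪ 1/log z` and `ρ₀(q)/q ≤ c_K(q)/q` -/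

/-- `ν_p = c_K(p)` (`cubeRootTwoCount p = idealNormCount K p`, Dedekind). [folklore] -/
theorem cubeRootTwoCount_eq_idealNormCount {p : ℕ} (hp : p.Prime) :
    cubeRootTwoCount p = idealNormCount K p := by
  rw [← card_absNorm_eq_prime_eq_cubeRootTwoCount hp]
  rfl

/-- `0 ≤ 1 − ρ₀(p)/p ≤ 1` and `ρ₀(p)/p ≥ c_K(p)/p − 3/p²` at a prime `p`. [folklore] -/
theorem densA_prime_bounds {p : ℕ} (hp : p.Prime) :
    0 ≤ 1 - densA p ∧ 1 - densA p ≤ 1 ∧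
      (idealNormCount K p : ℝ) / p - 3 / (p : ℝ) ^ 2 ≤ densA p := by
  rw [densA_prime hp, cubeRootTwoCount_eq_idealNormCount hp]
  have hp2 : (2 : ℝ) ≤ p := by exact_mod_cast hp.two_le
  have hp0 : (0 : ℝ) < p := by linarith
  have hc3 : (idealNormCount K p : ℝ) ≤ 3 := by
    rw [← cubeRootTwoCount_eq_idealNormCount hp]
    exact_mod_cast cubeRootTwoCount_le_three hp
  have hc0 : (0 : ℝ) ≤ idealNormCount K p := Nat.cast_nonneg _
  refine ⟨?_, ?_, ?_⟩
  · rw [sub_nonneg, div_le_one (by linarith)]; linarith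
  · have : 0 ≤ (idealNormCount K p : ℝ) / (p + 1) := by positivity
    linarith
  · -- `c/p − 3/p² ≤ c/(p+1)` since `c/p − c/(p+1) = c/(p(p+1)) ≤ 3/p²`
    rw [sub_le_iff_le_add, div_add_div _ _ (by positivity) (by positivity),
      div_le_div_iff₀ hp0 (by positivity)]
    nlinarith [mul_le_mul_of_nonneg_right hc3 (sq_nonneg (p : ℝ)), mul_nonneg hc0 hp0.le]

/-- **`V_𝒜(z) = ∏_{p<z} (1 − ρ₀(p)/p) ≤ K/log z`** for `z ≥ 2`: Mertens' theorem for the degree-one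
primes of `K` (`sum_primesLE_idealNormCount_div_eq`) and `ρ₀(p)/p ≥ c_K(p)/p − 3/p²`; this is the
upper bound (6.9) for the product `W(z)` of p. 38. [cite: HeathBrownActa2001, §6 (6.9)] -/
theorem exists_prod_one_sub_densA_le :
    ∃ Kv : ℝ, 0 < Kv ∧ ∀ z : ℝ, 2 ≤ z →
      ∏ p ∈ Nat.primesBelow ⌈z⌉₊, (1 - densA p) ≤ Kv / Real.log z := by
  obtain ⟨c, C, hM⟩ :=
    Literature.NumberTheory.LFunctions.NumberField.sum_primesLE_idealNormCount_div_eq (K := K) 0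
  have hl2 : 0 < Real.log 2 := Real.log_pos one_lt_two
  have hC0 : 0 ≤ C := by
    have h := hM 2 le_rfl
    rw [zero_add, pow_one] at h
    by_contra hneg
    have : C / Real.log 2 < 0 := div_neg_of_neg_of_pos (not_le.mp hneg) hl2
    linarith [abs_nonneg (∑ p ∈ Nat.primesLE ⌊(2 : ℝ)⌋₊, (idealNormCount K p : ℝ) / p -
      (Real.log (Real.log 2) + c))]
  set B : ℝ := Real.log 2 - c + C / Real.log 2 + 3 with hB
  refine ⟨max (Real.exp B) (Real.log 4), lt_max_of_lt_left (Real.exp_pos _), fun z hz => ?_⟩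
  have hlogz : 0 < Real.log z := Real.log_pos (by linarith)
  have hfac : ∀ p ∈ Nat.primesBelow ⌈z⌉₊, 0 ≤ 1 - densA p ∧ 1 - densA p ≤ 1 := by
    intro p hp
    obtain ⟨h0, h1, -⟩ := densA_prime_bounds (Nat.prime_of_mem_primesBelow hp)
    exact ⟨h0, h1⟩
  have hprod1 : ∏ p ∈ Nat.primesBelow ⌈z⌉₊, (1 - densA p) ≤ 1 :=
    prod_le_one (fun p hp => (hfac p hp).1) fun p hp => (hfac p hp).2
  rcases lt_or_ge z 4 with hz4 | hz4
  · calc ∏ p ∈ Nat.primesBelow ⌈z⌉₊, (1 - densA p) ≤ 1 := hprod1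
      _ ≤ Real.log 4 / Real.log z := by
          rw [le_div_iff₀ hlogz, one_mul]
          exact Real.log_le_log (by linarith) hz4.le
      _ ≤ max (Real.exp B) (Real.log 4) / Real.log z := by
          gcongr; exact le_max_right _ _
  · set n : ℕ := ⌈z⌉₊ - 1 with hn
    have hceil1 : 1 ≤ ⌈z⌉₊ := Nat.one_le_iff_ne_zero.mpr (Nat.ceil_pos.mpr (by linarith)).ne'
    have hn1 : ⌈z⌉₊ = n + 1 := by rw [hn]; omega
    have hnz : z - 1 ≤ n := by
      have h1 : (n : ℝ) = ⌈z⌉₊ - 1 := by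
        rw [hn, Nat.cast_sub hceil1, Nat.cast_one]
      rw [h1]; linarith [Nat.le_ceil z]
    have hn2 : (2 : ℝ) ≤ n := by linarith
    have hPB : Nat.primesBelow ⌈z⌉₊ = Nat.primesLE n := by rw [hn1]; rfl
    rw [hPB]
    have h1 : ∏ p ∈ Nat.primesLE n, (1 - densA p) ≤
        Real.exp (-(∑ p ∈ Nat.primesLE n, densA p)) := by
      rw [← Finset.sum_neg_distrib, Real.exp_sum]
      refine prod_le_prod (fun p hp => ?_) fun p hp => ?_
      · exact (densA_prime_bounds (Nat.mem_primesLE.mp hp).2).1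
      · linarith [Real.add_one_le_exp (-(densA p))]
    have h2 : ∑ p ∈ Nat.primesLE n, ((idealNormCount K p : ℝ) / p - 3 / (p : ℝ) ^ 2) ≤
        ∑ p ∈ Nat.primesLE n, densA p :=
      sum_le_sum fun p hp => (densA_prime_bounds (Nat.mem_primesLE.mp hp).2).2.2
    have h3 : ∑ p ∈ Nat.primesLE n, (3 : ℝ) / (p : ℝ) ^ 2 ≤ 3 := by
      have h := Literature.NumberTheory.LFunctions.MertensBound.sum_inv_prime_mul_pred_le_one n
      have hle : ∑ p ∈ Nat.primesLE n, (3 : ℝ) / (p : ℝ) ^ 2 ≤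
          ∑ p ∈ Nat.primesLE n, 3 * (1 / ((p : ℝ) * ((p : ℝ) - 1))) := by
        refine sum_le_sum fun p hp => ?_
        have hp2 : (2 : ℝ) ≤ p := by exact_mod_cast (Nat.mem_primesLE.mp hp).2.two_le
        have hpos : (0 : ℝ) < p * (p - 1) := mul_pos (by linarith) (by linarith)
        have hle1 : (1 : ℝ) / (p : ℝ) ^ 2 ≤ 1 / ((p : ℝ) * ((p : ℝ) - 1)) :=
          div_le_div_of_nonneg_left zero_le_one hpos (by nlinarith)
        calc (3 : ℝ) / (p : ℝ) ^ 2 = 3 * (1 / (p : ℝ) ^ 2) := by ring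
          _ ≤ 3 * (1 / ((p : ℝ) * ((p : ℝ) - 1))) := by gcongr
      rw [← mul_sum] at hle
      linarith
    have h4 := hM n hn2
    rw [Nat.floor_natCast, zero_add, pow_one] at h4
    have hlogn : Real.log 2 ≤ Real.log n := Real.log_le_log two_pos hn2
    have hCn : C / Real.log n ≤ C / Real.log 2 := div_le_div_of_nonneg_left hC0 hl2 hlogn
    have h5 : Real.log (Real.log n) + c - C / Real.log 2 ≤
        ∑ p ∈ Nat.primesLE n, (idealNormCount K p : ℝ) / p := by
      have := (abs_le.mp h4).1
      linarith
    have h6 : Real.log (Real.log z) - Real.log 2 ≤ Real.log (Real.log n) := by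
      have hz0 : 0 < z := by linarith
      have hnz2 : z / 2 ≤ n := by linarith
      have hlog4 : Real.log 4 = 2 * Real.log 2 := by
        rw [show (4 : ℝ) = 2 ^ 2 by norm_num, Real.log_pow]; push_cast; ring
      have hlz2 : 2 * Real.log 2 ≤ Real.log z := by
        rw [← hlog4]; exact Real.log_le_log (by norm_num) hz4
      have hln : Real.log z - Real.log 2 ≤ Real.log n := by
        rw [← Real.log_div hz0.ne' two_ne_zero]
        exact Real.log_le_log (by positivity) hnz2
      have hhalf : Real.log z / 2 ≤ Real.log n := by linarith
      calc Real.log (Real.log z) - Real.log 2 = Real.log (Real.log z / 2) := by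
            rw [Real.log_div hlogz.ne' two_ne_zero]
        _ ≤ Real.log (Real.log n) := Real.log_le_log (by positivity) hhalf
    have h7 : Real.log (Real.log z) - B ≤ ∑ p ∈ Nat.primesLE n, densA p := by
      rw [sum_sub_distrib] at h2
      rw [hB]
      linarith
    calc ∏ p ∈ Nat.primesLE n, (1 - densA p)
        ≤ Real.exp (-(∑ p ∈ Nat.primesLE n, densA p)) := h1
      _ ≤ Real.exp (-(Real.log (Real.log z) - B)) := Real.exp_le_exp.mpr (by linarith)
      _ = Real.exp B / Real.log z := by
          rw [neg_sub, Real.exp_sub, Real.exp_log hlogz]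
      _ ≤ max (Real.exp B) (Real.log 4) / Real.log z := by
          gcongr; exact le_max_left _ _

/-- **`ρ₀(q)/q ≤ c_K(q)/q = ∑_{N(Q) = q} N(Q)^{-1}`** for square-free `q` (`ν_p/(p+1) ≤ ν_p/p` and
`c_K(q) = ∏_{p∣q} ν_p`): the correction of the weight of Lemma 7.1 recorded in
`HeathBrownCubicUpperBound` ("the factor `ρ₀(q)` dropped on p. 40 is restored").
[cite: HeathBrownActa2001, Lemma 7.1] -/
theorem densA_le_card_normEq_div {q : ℕ} (hq : Squarefree q) :
    densA q ≤ (#(normEq q) : ℝ) / q := by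
  have hq0 : q ≠ 0 := hq.ne_zero
  rw [card_normEq, idealNormCount_eq_prod_of_squarefree hq, densA_apply hq0,
    show ((q : ℕ) : ℝ) = ∏ p ∈ q.primeFactors, (p : ℝ) by
      rw [← Nat.cast_prod, Nat.prod_primeFactors_of_squarefree hq]]
  push_cast
  rw [← prod_div_distrib]
  refine prod_le_prod (fun p _ => div_nonneg (rho₀_nonneg p) (Nat.cast_nonneg p)) fun p hp => ?_
  have hpp := Nat.prime_of_mem_primeFactors hp
  have hp0 : (0 : ℝ) < p := by exact_mod_cast hpp.pos
  rw [rho₀_div_eq hpp.pos]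
  exact div_le_div_of_nonneg_left (Nat.cast_nonneg _) hp0 (by linarith)

/-! ### The sifted sequence `𝒜_q`: dictionary complements -/

/-- `V(P(z)) = ∏_{p<z} (1 − ρ₀(p)/p)` for `𝒜_q`. [folklore] -/
theorem seqA_densityProduct (X η : ℝ) (q : ℕ) (z : ℝ) :
    (seqA X η q).densityProduct (primesProdBelow z) = ∏ p ∈ Nat.primesBelow ⌈z⌉₊, (1 - densA p) := by
  rw [SieveSequence.densityProduct, primeFactors_primesProdBelow]
  rfl

open scoped Classical in
/-- **`∑_{N(Q) = q} S_K(𝒜^(K)_Q, z) ≤ S(𝒜_q, P(z₂))`** for square-free `q` and `z₂ ≤ z`: a member of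
`𝒜^(K)_Q` with no prime factor of norm `< z` has norm `x³ + 2y³` divisible by `q` and free of primes
`< z₂` (Lemma 3.1, `NormSimple.isRough_iff_coprime`), and is counted for at most one `Q` (an ideal
of square-free norm dividing `(x + yθ)` is determined by its norm, `NormSimple.eq_prod_filter_of_dvd`;
p. 33). The inequality half of (6.2), p. 34. [cite: HeathBrownActa2001, §6 (6.2)] -/
theorem sum_normEq_siftedA_le_sifted_seqA {X η z z₂ : ℝ} (hX : 0 ≤ X) (hz : z₂ ≤ z) {q : ℕ}
    (hq : Squarefree q) :
    ∑ Q ∈ normEq q, (siftedA X η Q z : ℝ) ≤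
      (seqA X η q).sifted (topA X η) (primesProdBelow z₂) := by
  set T : Ideal (𝓞 K) → Finset (ℕ × ℕ) := fun Q => {xy ∈ APairs X η Q | IsRough z (pairIdeal xy)}
    with hT
  have hsift : ∀ Q, siftedA X η Q z = #(T Q) := fun Q => rfl
  -- the sets `T Q`, `N(Q) = q`, are pairwise disjoint
  have hdisj : ∀ Q ∈ normEq q, ∀ Q' ∈ normEq q, Q ≠ Q' → Disjoint (T Q) (T Q') := by
    intro Q hQ Q' hQ' hne
    rw [mem_normEq] at hQ hQ'
    refine disjoint_left.mpr fun xy hxy hxy' => hne ?_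
    rw [hT, mem_filter, mem_APairs_iff] at hxy hxy'
    have hbox := hxy.1.1
    have h0 : pairIdeal xy ≠ ⊥ := pairIdeal_ne_bot_of_mem_boxPairs hX xy hbox
    have hI : NormSimple (pairIdeal xy) := normSimple_pairIdeal (isCoprime_of_mem_boxPairs hbox)
    rw [hI.eq_prod_filter_of_dvd h0 hxy.1.2 (hQ ▸ hq), hI.eq_prod_filter_of_dvd h0 hxy'.1.2 (hQ' ▸ hq),
      hQ, hQ']
  -- each `T Q` lies in the set counted by `S(𝒜_q, P(z₂))`
  have hsub : (normEq q).biUnion T ⊆ {xy ∈ boxPairs X η | q ∣ xy.1 ^ 3 + 2 * xy.2 ^ 3 ∧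
      (xy.1 ^ 3 + 2 * xy.2 ^ 3).Coprime (primesProdBelow z₂)} := by
    intro xy hxy
    rw [mem_biUnion] at hxy
    obtain ⟨Q, hQ, hxy⟩ := hxy
    rw [mem_normEq] at hQ
    rw [hT, mem_filter, mem_APairs_iff] at hxy
    obtain ⟨⟨hbox, hQI⟩, hrough⟩ := hxy
    have h0 : pairIdeal xy ≠ ⊥ := pairIdeal_ne_bot_of_mem_boxPairs hX xy hbox
    have hI : NormSimple (pairIdeal xy) := normSimple_pairIdeal (isCoprime_of_mem_boxPairs hbox)
    rw [mem_filter, ← absNorm_pairIdeal]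
    refine ⟨hbox, ?_, (hI.isRough_iff_coprime h0 z₂).mp (IsRough.mono hz hrough)⟩
    rw [← hQ]
    exact Ideal.absNorm_dvd_absNorm_of_le (Ideal.le_of_dvd hQI)
  have hnat : ∑ Q ∈ normEq q, siftedA X η Q z ≤
      #{xy ∈ boxPairs X η | q ∣ xy.1 ^ 3 + 2 * xy.2 ^ 3 ∧
        (xy.1 ^ 3 + 2 * xy.2 ^ 3).Coprime (primesProdBelow z₂)} := by
    calc ∑ Q ∈ normEq q, siftedA X η Q z = ∑ Q ∈ normEq q, #(T Q) := sum_congr rfl fun Q _ => hsift Q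
      _ = #((normEq q).biUnion T) := (card_biUnion hdisj).symm
      _ ≤ _ := card_le_card hsub
  rw [sifted_seqA_eq hX]
  calc ∑ Q ∈ normEq q, (siftedA X η Q z : ℝ)
      ≤ (#{xy ∈ boxPairs X η | q ∣ xy.1 ^ 3 + 2 * xy.2 ^ 3 ∧
          (xy.1 ^ 3 + 2 * xy.2 ^ 3).Coprime (primesProdBelow z₂)} : ℝ) := by exact_mod_cast hnat
    _ = _ := by congr

/-- **`S_K(𝒜^(K)_Q, z) = 0` when `N(Q)` is square-free with a prime factor `p < z`**: then a prime
ideal of norm `p` divides `Q` and hence every member of `𝒜^(K)_Q` (Lemma 3.1; p. 40: "Clearly we may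
suppose that every prime factor `p` of an element `q ∈ 𝒬` satisfies `p ≥ z`, since otherwise
`S(𝒜_q, z)` vanishes"). [cite: HeathBrownActa2001, §7 p. 40] -/
theorem siftedA_eq_zero_of_prime_dvd {X η z : ℝ} {Q : Ideal (𝓞 K)} (hQ : Squarefree (Ideal.absNorm Q))
    {p : ℕ} (hp : p.Prime) (hpq : p ∣ Ideal.absNorm Q) (hpz : (p : ℝ) < z) :
    siftedA X η Q z = 0 := by
  classical
  have hQ0 : Q ≠ ⊥ := fun h => by
    rw [h, Ideal.absNorm_bot] at hQ; exact not_squarefree_zero hQ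
  obtain ⟨P, hP, -, hPQ, hNP⟩ :=
    (normSimple_of_squarefree_absNorm hQ).exists_prime_dvd_of_dvd_absNorm hQ0 hp hpq
  rw [siftedA, card_eq_zero, filter_eq_empty_iff]
  intro xy hxy hrough
  rw [mem_APairs_iff] at hxy
  have h := hrough hP (hPQ.trans hxy.2)
  rw [hNP] at h
  linarith

/-! ### The Type I input: Lemma 3.2 (`HeathBrown2001_typeI_A`) summed over dyadic blocks -/

/-- `2^{⌊log b/log 2⌋} ≤ b` for `b ≥ 1`. [folklore] -/
theorem two_pow_floor_log_le {b : ℝ} (hb : 1 ≤ b) :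
    (2 : ℝ) ^ ⌊Real.log b / Real.log 2⌋₊ ≤ b := by
  have hl2 : 0 < Real.log 2 := Real.log_pos one_lt_two
  have h0 : 0 ≤ Real.log b / Real.log 2 := div_nonneg (Real.log_nonneg hb) hl2.le
  calc (2 : ℝ) ^ ⌊Real.log b / Real.log 2⌋₊ = (2 : ℝ) ^ ((⌊Real.log b / Real.log 2⌋₊ : ℕ) : ℝ) := by
        rw [Real.rpow_natCast]
    _ ≤ (2 : ℝ) ^ (Real.log b / Real.log 2) :=
        Real.rpow_le_rpow_of_exponent_le one_le_two (Nat.floor_le h0)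
    _ = b := by
        rw [Real.rpow_def_of_pos two_pos, show Real.log 2 * (Real.log b / Real.log 2) = Real.log b by
          field_simp, Real.exp_log (by linarith)]

/-- **Lemma 3.2 summed dyadically**: from `HeathBrown2001_typeI_A` (with `A = 1`) there are `k, C`
such that for `X ≥ 3`, `η` in the range (2.1) and `1 ≤ B ≤ X³`,
`∑_{2 ≤ N(R) ≤ B, N(R) square-free} |#𝒜^(K)_R − X_𝒜 ρ₂(R)/N(R)| ≤ C (B + X√B + X^{3/2}) (log X)^{k+1}`
(at most `log(B+1)/log 2 + 1 ≤ 7 log X` blocks `(2^j, 2^{j+1}]`, each bounded by Lemma 3.2 with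
`(log(2^jX))^c ≤ (5 log X)^k`). This is the form "use Lemmas 3.2 and 3.3 to bound the error terms …
Since `Nz₀² ≤ X^{2−τ}`", p. 40. [cite: HeathBrownActa2001, §7 p. 40] -/
theorem exists_typeI_dyadic (hA : HeathBrown2001_typeI_A) :
    ∃ (k : ℕ) (C : ℝ), 0 ≤ C ∧ ∀ X η B : ℝ, 3 ≤ X →
      Real.exp (-Real.log X ^ (1 / 3 : ℝ)) ≤ η → η ≤ 1 → 1 ≤ B → B ≤ X ^ 3 →
      ∑ R ∈ (idealsLE ⌊B⌋₊).filter (fun R => 2 ≤ Ideal.absNorm R ∧ Squarefree (Ideal.absNorm R)),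
          |(countA X η R : ℝ) - sizeA X η * rho₂ R / Ideal.absNorm R| ≤
        C * (B + X * Real.sqrt B + X ^ (3 / 2 : ℝ)) * Real.log X ^ (k + 1) := by
  classical
  obtain ⟨c, C, hC⟩ := hA 1 one_pos
  set k : ℕ := ⌈max c 0⌉₊ with hk
  refine ⟨k, 14 * 5 ^ k * max C 0, by positivity, fun X η B hX hηlo hη1 hB1 hBX => ?_⟩
  set 𝓡 := (idealsLE ⌊B⌋₊).filter (fun R => 2 ≤ Ideal.absNorm R ∧ Squarefree (Ideal.absNorm R))
    with h𝓡
  set J : ℕ := ⌊Real.log (B + 1) / Real.log 2⌋₊ with hJ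
  have hX2 : 2 ≤ X := by linarith
  have hX0 : 0 < X := by linarith
  have hX1 : 1 ≤ X := by linarith
  have hl2 : 0 < Real.log 2 := Real.log_pos one_lt_two
  have hlogX1 : 1 ≤ Real.log X := by
    rw [← Real.log_exp 1]
    refine Real.log_le_log (Real.exp_pos 1) ?_
    have := Real.exp_one_lt_d9
    linarith
  have hlogX0 : 0 < Real.log X := by linarith
  have hB0 : 0 < B := by linarith
  set E : Ideal (𝓞 K) → ℝ := fun R => |(countA X η R : ℝ) - sizeA X η * rho₂ R / Ideal.absNorm R|
    with hE
  have hE0 : ∀ R, 0 ≤ E R := fun R => abs_nonneg _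
  -- every `R` lies in a block `j ≤ J`
  have hmaps : ∀ R ∈ 𝓡, dyadIdx (Ideal.absNorm R) ∈ range (J + 1) := by
    intro R hR
    rw [h𝓡, mem_filter, mem_idealsLE] at hR
    obtain ⟨hRB, h2, -⟩ := hR
    rw [mem_range, Nat.lt_succ_iff, hJ]
    refine Nat.le_floor (dyadIdx_le_log h2 ?_)
    have : (Ideal.absNorm R : ℝ) ≤ ⌊B⌋₊ := by exact_mod_cast hRB
    linarith [Nat.floor_le hB0.le]
  rw [← sum_fiberwise_of_maps_to hmaps]
  -- the bound for one block
  have h2J : (2 : ℝ) ^ J ≤ B + 1 := two_pow_floor_log_le (by linarith)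
  have hblock : ∀ j ∈ range (J + 1),
      ∑ R ∈ 𝓡.filter (fun R => dyadIdx (Ideal.absNorm R) = j), E R ≤
        max C 0 * (2 * (B + X * Real.sqrt B + X ^ (3 / 2 : ℝ))) * (5 * Real.log X) ^ k := by
    intro j hj
    rw [mem_range, Nat.lt_succ_iff] at hj
    set Q' : ℝ := (2 : ℝ) ^ j with hQ'
    have hQ'1 : 1 ≤ Q' := one_le_pow₀ one_le_two
    have hQ'B : Q' ≤ B + 1 := (pow_le_pow_right₀ one_le_two hj).trans h2J
    have h := hC X η Q' hX2 hηlo hη1 hQ'1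
    have hsub : 𝓡.filter (fun R => dyadIdx (Ideal.absNorm R) = j) ⊆
        (idealsLE ⌊2 * Q'⌋₊).filter (fun R => Q' < (Ideal.absNorm R : ℝ) ∧
          (Ideal.absNorm R : ℝ) ≤ 2 * Q' ∧ Squarefree (Ideal.absNorm R)) := by
      intro R hR
      rw [mem_filter, h𝓡, mem_filter, mem_idealsLE] at hR
      obtain ⟨⟨-, h2, hsq⟩, hjR⟩ := hR
      have hlt := pow_dyadIdx_lt h2
      have hle := le_pow_dyadIdx_succ (Ideal.absNorm R)
      rw [hjR] at hlt hle
      have hfloor : ⌊2 * Q'⌋₊ = 2 ^ (j + 1) := by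
        rw [hQ', show (2 : ℝ) * 2 ^ j = ((2 ^ (j + 1) : ℕ) : ℝ) by push_cast; ring, Nat.floor_natCast]
      rw [mem_filter, mem_idealsLE, hfloor]
      refine ⟨hle, ?_, ?_, hsq⟩
      · rw [hQ']; exact_mod_cast hlt
      · have : ((Ideal.absNorm R : ℕ) : ℝ) ≤ ((2 ^ (j + 1) : ℕ) : ℝ) := by exact_mod_cast hle
        rw [hQ']
        push_cast at this
        rw [pow_succ] at this
        linarith
    have hpt : ∀ R ∈ 𝓡.filter (fun R => dyadIdx (Ideal.absNorm R) = j), E R ≤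
        (idealDivisorCount R : ℝ) ^ 1 *
          |(countA X η R : ℝ) - 6 * η ^ 2 * X ^ 2 / Real.pi ^ 2 * rho₂ R / Ideal.absNorm R| := by
      intro R hR
      rw [mem_filter, h𝓡, mem_filter] at hR
      have hR0 : R ≠ ⊥ := fun h0 => by
        have := hR.1.2.1; rw [h0, Ideal.absNorm_bot] at this; omega
      have hτ : (1 : ℝ) ≤ (idealDivisorCount R : ℝ) ^ 1 := by
        rw [pow_one]; exact_mod_cast one_le_idealDivisorCount hR0
      rw [hE]
      simp only [sizeA]
      exact le_mul_of_one_le_left (abs_nonneg _) hτ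
    have hnn : ∀ R ∈ (idealsLE ⌊2 * Q'⌋₊).filter (fun R => Q' < (Ideal.absNorm R : ℝ) ∧
          (Ideal.absNorm R : ℝ) ≤ 2 * Q' ∧ Squarefree (Ideal.absNorm R)),
        0 ≤ (idealDivisorCount R : ℝ) ^ 1 *
          |(countA X η R : ℝ) - 6 * η ^ 2 * X ^ 2 / Real.pi ^ 2 * rho₂ R / Ideal.absNorm R| :=
      fun R _ => by positivity
    -- the logarithm: `log(Q'X)^c ≤ (5 log X)^k`
    have hQX1 : 1 ≤ Real.log (Q' * X) := by
      calc (1 : ℝ) ≤ Real.log X := hlogX1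
        _ ≤ Real.log (Q' * X) := Real.log_le_log hX0 (le_mul_of_one_le_left hX0.le hQ'1)
    have hlogQX : Real.log (Q' * X) ≤ 5 * Real.log X := by
      have hQ'X : Q' * X ≤ X ^ 5 := by
        have hB2 : B + 1 ≤ 2 * X ^ 3 := by nlinarith [one_le_pow₀ (n := 3) hX1]
        calc Q' * X ≤ (2 * X ^ 3) * X := by gcongr; linarith
          _ = 2 * X ^ 4 := by ring
          _ ≤ X * X ^ 4 := by gcongr
          _ = X ^ 5 := by ring
      calc Real.log (Q' * X) ≤ Real.log (X ^ 5) := Real.log_le_log (by positivity) hQ'X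
        _ = 5 * Real.log X := by rw [Real.log_pow]; push_cast; ring
    have hck : c ≤ (k : ℝ) := (le_max_left c 0).trans (Nat.le_ceil _)
    have hlogpow : Real.log (Q' * X) ^ c ≤ (5 * Real.log X) ^ k := by
      calc Real.log (Q' * X) ^ c ≤ Real.log (Q' * X) ^ (k : ℝ) :=
            Real.rpow_le_rpow_of_exponent_le hQX1 hck
        _ = Real.log (Q' * X) ^ k := Real.rpow_natCast _ _
        _ ≤ (5 * Real.log X) ^ k := pow_le_pow_left₀ (by linarith) hlogQX k
    have hgeom : Q' + X * Real.sqrt Q' + X ^ (3 / 2 : ℝ) ≤ 2 * (B + X * Real.sqrt B + X ^ (3 / 2 : ℝ)) := by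
      have hs : Real.sqrt Q' ≤ 2 * Real.sqrt B := by
        calc Real.sqrt Q' ≤ Real.sqrt (4 * B) := Real.sqrt_le_sqrt (by linarith)
          _ = 2 * Real.sqrt B := by
              rw [Real.sqrt_mul (by norm_num), show (4 : ℝ) = 2 ^ 2 by norm_num,
                Real.sqrt_sq (by norm_num)]
      have hX32 : 0 ≤ X ^ (3 / 2 : ℝ) := by positivity
      nlinarith [mul_le_mul_of_nonneg_left hs hX0.le, Real.sqrt_nonneg B]
    calc ∑ R ∈ 𝓡.filter (fun R => dyadIdx (Ideal.absNorm R) = j), E R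
        ≤ ∑ R ∈ 𝓡.filter (fun R => dyadIdx (Ideal.absNorm R) = j), (idealDivisorCount R : ℝ) ^ 1 *
            |(countA X η R : ℝ) - 6 * η ^ 2 * X ^ 2 / Real.pi ^ 2 * rho₂ R / Ideal.absNorm R| :=
          sum_le_sum hpt
      _ ≤ ∑ R ∈ (idealsLE ⌊2 * Q'⌋₊).filter (fun R => Q' < (Ideal.absNorm R : ℝ) ∧
            (Ideal.absNorm R : ℝ) ≤ 2 * Q' ∧ Squarefree (Ideal.absNorm R)),
            (idealDivisorCount R : ℝ) ^ 1 *
              |(countA X η R : ℝ) - 6 * η ^ 2 * X ^ 2 / Real.pi ^ 2 * rho₂ R / Ideal.absNorm R| :=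
          sum_le_sum_of_subset_of_nonneg hsub fun R hR _ => hnn R hR
      _ ≤ C * (Q' + X * Real.sqrt Q' + X ^ (3 / 2 : ℝ)) * Real.log (Q' * X) ^ c := h
      _ ≤ max C 0 * (Q' + X * Real.sqrt Q' + X ^ (3 / 2 : ℝ)) * Real.log (Q' * X) ^ c :=
          mul_le_mul_of_nonneg_right (mul_le_mul_of_nonneg_right (le_max_left _ _) (by positivity))
            (Real.rpow_nonneg (by linarith) _)
      _ ≤ max C 0 * (2 * (B + X * Real.sqrt B + X ^ (3 / 2 : ℝ))) * (5 * Real.log X) ^ k := by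
          gcongr
  -- the number of blocks
  have hJle : ((J + 1 : ℕ) : ℝ) ≤ 7 * Real.log X := by
    have h1 : (J : ℝ) ≤ Real.log (B + 1) / Real.log 2 :=
      Nat.floor_le (div_nonneg (Real.log_nonneg (by linarith)) hl2.le)
    have h2 : Real.log (B + 1) ≤ 4 * Real.log X := by
      have hB2 : B + 1 ≤ X ^ 4 := by nlinarith [one_le_pow₀ (n := 3) hX1]
      calc Real.log (B + 1) ≤ Real.log (X ^ 4) := Real.log_le_log (by linarith) hB2
        _ = 4 * Real.log X := by rw [Real.log_pow]; push_cast; ring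
    have h3 : Real.log (B + 1) / Real.log 2 ≤ 6 * Real.log X := by
      rw [div_le_iff₀ hl2]
      have h69 := Real.log_two_gt_d9
      have : 0.6931471803 * (6 * Real.log X) ≤ Real.log 2 * (6 * Real.log X) :=
        mul_le_mul_of_nonneg_right h69.le (by positivity)
      nlinarith
    push_cast
    linarith
  calc ∑ j ∈ range (J + 1), ∑ R ∈ 𝓡.filter (fun R => dyadIdx (Ideal.absNorm R) = j), E R
      ≤ ∑ j ∈ range (J + 1),
          max C 0 * (2 * (B + X * Real.sqrt B + X ^ (3 / 2 : ℝ))) * (5 * Real.log X) ^ k :=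
        sum_le_sum hblock
    _ = ((J + 1 : ℕ) : ℝ) *
          (max C 0 * (2 * (B + X * Real.sqrt B + X ^ (3 / 2 : ℝ))) * (5 * Real.log X) ^ k) := by
        rw [sum_const, card_range, nsmul_eq_mul]
    _ ≤ (7 * Real.log X) *
          (max C 0 * (2 * (B + X * Real.sqrt B + X ^ (3 / 2 : ℝ))) * (5 * Real.log X) ^ k) :=
        mul_le_mul_of_nonneg_right hJle
          (mul_nonneg (mul_nonneg (le_max_right C 0) (by positivity)) (pow_nonneg (by linarith) k))
    _ = 14 * 5 ^ k * max C 0 * (B + X * Real.sqrt B + X ^ (3 / 2 : ℝ)) * Real.log X ^ (k + 1) := by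
        rw [mul_pow, pow_succ]; ring

/-- **Disjointness of the remainders over `(q, d)`**: for `q ∈ 𝒬` coprime to `P` and `d ∈ D` divisors
of `P`, the ideals of norm `qd` are distinct for distinct `(q, d)` (`d = (qd, P)`), so a triple sum
of non-negative terms over `q`, `d` and `N(R) = qd` is at most the sum over any set of ideals
containing all of them. [folklore] -/
theorem sum_sum_normEq_le {𝒬 D : Finset ℕ} {P : ℕ} (hD : ∀ d ∈ D, d ∣ P) (hD0 : ∀ d ∈ D, d ≠ 0)
    (h𝒬 : ∀ q ∈ 𝒬, q.Coprime P) {f : Ideal (𝓞 K) → ℝ} (hf : ∀ R, 0 ≤ f R)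
    (T : Finset (Ideal (𝓞 K))) (hT : ∀ q ∈ 𝒬, ∀ d ∈ D, normEq (q * d) ⊆ T) :
    ∑ q ∈ 𝒬, ∑ d ∈ D, ∑ R ∈ normEq (q * d), f R ≤ ∑ R ∈ T, f R := by
  classical
  rw [← sum_product']
  have hdisj : ((𝒬 ×ˢ D : Finset (ℕ × ℕ)) : Set (ℕ × ℕ)).PairwiseDisjoint
      fun x => normEq (x.1 * x.2) := by
    intro x hx y hy hne
    rw [Function.onFun, disjoint_left]
    intro R hRx hRy
    rw [mem_normEq] at hRx hRy
    apply hne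
    have heq : x.1 * x.2 = y.1 * y.2 := hRx.symm.trans hRy
    rw [mem_coe, mem_product] at hx hy
    have hdx : x.2 = Nat.gcd (x.1 * x.2) P := by
      rw [Nat.Coprime.gcd_mul_left_cancel x.2 (h𝒬 _ hx.1), Nat.gcd_eq_left (hD _ hx.2)]
    have hdy : y.2 = Nat.gcd (y.1 * y.2) P := by
      rw [Nat.Coprime.gcd_mul_left_cancel y.2 (h𝒬 _ hy.1), Nat.gcd_eq_left (hD _ hy.2)]
    have hd : x.2 = y.2 := by rw [hdx, hdy, heq]
    have hq : x.1 = y.1 := by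
      rw [hd] at heq
      exact Nat.eq_of_mul_eq_mul_right (Nat.pos_of_ne_zero (hD0 _ hy.2)) heq
    exact Prod.ext hq hd
  rw [← sum_biUnion hdisj]
  refine sum_le_sum_of_subset_of_nonneg (biUnion_subset.mpr fun x hx => ?_) fun R _ _ => hf R
  exact hT _ (mem_product.mp hx).1 _ (mem_product.mp hx).2

/-- `ρ₂(⊤) = 1` and `#𝒜^(K)_⊤ = #𝒜^(K)`: the remainder at `R = 1` is `#𝒜^(K) − X_𝒜`. [folklore] -/
theorem countA_top_sub_eq (X η : ℝ) :
    (countA X η ⊤ : ℝ) - sizeA X η * rho₂ ⊤ / Ideal.absNorm (⊤ : Ideal (𝓞 K)) =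
      (#(boxPairs X η) : ℝ) - sizeA X η := by
  have hρ : rho₂ (⊤ : Ideal (𝓞 K)) = 1 := by
    rw [rho₂_eq_of_squarefree (by rw [Ideal.absNorm_top]; exact squarefree_one), Ideal.absNorm_top,
      Nat.primeFactors_one, prod_empty]
  rw [hρ, Ideal.absNorm_top, Nat.cast_one, mul_one, div_one, countA, ← Ideal.one_eq_top, APairs_one]

/-! ### Lemma 7.1, the `𝒜^(K)`-half, from Lemma 3.2: the pieces -/

/-- Eventually in `X`: `C(1 + log X) ≤ X^{1/2}` (absorption of the remainder `R_1 ≪ X log X`). [folklore] -/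
theorem eventually_log_le_sqrt {C : ℝ} (hC : 0 < C) :
    ∀ᶠ X : ℝ in atTop, C * (1 + Real.log X) ≤ X ^ (1 / 2 : ℝ) := by
  have h := (isLittleO_log_rpow_atTop (by norm_num : (0 : ℝ) < 1 / 2)).def
    (by positivity : (0 : ℝ) < 1 / (2 * C))
  filter_upwards [h, Real.tendsto_log_atTop.eventually (eventually_ge_atTop (1 : ℝ)),
    eventually_ge_atTop (1 : ℝ)] with X hX hL1 hX1
  rw [Real.norm_eq_abs, Real.norm_eq_abs, abs_of_nonneg (by linarith),
    abs_of_nonneg (Real.rpow_nonneg (by linarith) _)] at hX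
  have hkey : C * (1 + Real.log X) ≤ 2 * C * Real.log X := by nlinarith
  have h2 : 2 * C * Real.log X ≤ X ^ (1 / 2 : ℝ) := by
    have := mul_le_mul_of_nonneg_left hX (by positivity : (0 : ℝ) ≤ 2 * C)
    rw [← mul_assoc, show 2 * C * (1 / (2 * C)) = 1 by field_simp, one_mul] at this
    exact this
  linarith

/-- **The sieve bound for the ideals of one norm `q`** (the heart of Lemma 7.1 for `𝒜^(K)`): for
square-free `q > N` coprime to `P(z₂)`, `z₂ = z₁^{1/28}`, `e^{20} ≤ z₁ ≤ z`,
`∑_{N(Q)=q} S_K(𝒜^(K)_Q, z) ≤ S(𝒜_q, P(z₂)) ≤ (1 + 2K₃^{10}) X_𝒜 (ρ₀(q)/q) V(z₂) + ∑_{d ≤ z₁} |R_d(𝒜_q)|`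
with the main term `≤ 28(1+2K₃^{10})(6/π²)K_V · η²X²/log z₁ · c_K(q)/q` and the remainders bounded by
the Type I errors at the ideals of norm `qd` (`abs_remainder_seqA_le`).
[cite: HeathBrownActa2001, Lemma 7.1 (proof, pp. 40–41)] -/
theorem sum_normEq_siftedA_le_main_add_err {Kv K₃ : ℝ}
    (hKv : ∀ z : ℝ, 2 ≤ z → ∏ p ∈ Nat.primesBelow ⌈z⌉₊, (1 - densA p) ≤ Kv / Real.log z)
    (hdim : HasSieveDimension densA 3 K₃)
    {X η z z₁ : ℝ} (hX : 0 < X) (hz₁20 : Real.exp 20 ≤ z₁) (hz₁z : z₁ ≤ z)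
    {q : ℕ} (hsq : Squarefree q) (hq0 : 0 < q) (hcop : q.Coprime (primesProdBelow (z₁ ^ (1 / 28 : ℝ)))) :
    ∑ Q ∈ normEq q, (siftedA X η Q z : ℝ) ≤
      (1 + 2 * K₃ ^ 10) * (6 / Real.pi ^ 2) * Kv * 28 * (η ^ 2 * X ^ 2 / Real.log z₁) *
          ((#(normEq q) : ℝ) / q) +
        ∑ d ∈ (primesProdBelow (z₁ ^ (1 / 28 : ℝ))).divisors.filter (fun d : ℕ => (d : ℝ) ≤ z₁),
          ∑ R ∈ normEq (q * d), |(countA X η R : ℝ) - sizeA X η * rho₂ R / Ideal.absNorm R| := by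
  -- `z₁`, `z₂`
  have hz₁1 : 1 < z₁ := lt_of_lt_of_le (Real.one_lt_exp_iff.mpr (by norm_num)) hz₁20
  have hz₁0 : 0 < z₁ := by linarith
  have hL₁ : 0 < Real.log z₁ := Real.log_pos hz₁1
  have hL₁20 : 20 ≤ Real.log z₁ := by
    rw [← Real.log_exp 20]; exact Real.log_le_log (Real.exp_pos _) hz₁20
  set z₂ := z₁ ^ (1 / 28 : ℝ) with hz₂
  have hz₂pos : 0 < z₂ := Real.rpow_pos_of_pos hz₁0 _
  have hlogz₂ : Real.log z₂ = Real.log z₁ / 28 := by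
    rw [hz₂, Real.log_rpow hz₁0]; ring
  have hlogz₂0 : 0 < Real.log z₂ := by rw [hlogz₂]; positivity
  have hz₂2 : 2 ≤ z₂ := by
    have h : Real.log 2 ≤ Real.log z₂ := by
      rw [hlogz₂]; have := Real.log_two_lt_d9; linarith
    exact (Real.log_le_log_iff two_pos hz₂pos).mp h
  have hz₂z₁ : z₂ ≤ z₁ := by
    calc z₂ = z₁ ^ (1 / 28 : ℝ) := rfl
      _ ≤ z₁ ^ (1 : ℝ) := Real.rpow_le_rpow_of_exponent_le hz₁1.le (by norm_num)
      _ = z₁ := Real.rpow_one z₁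
  have hz₂z : z₂ ≤ z := hz₂z₁.trans hz₁z
  have hzD : (9 * 3 + 1) * Real.log z₂ ≤ Real.log z₁ := by rw [hlogz₂]; linarith
  have hexp1 : Real.exp ((9 * 3 + 1) - Real.log z₁ / Real.log z₂) = 1 := by
    rw [hlogz₂, show ((9 : ℝ) * 3 + 1) - Real.log z₁ / (Real.log z₁ / 28) = 0 by
      field_simp; ring]
    exact Real.exp_zero
  have hq0' : (0 : ℝ) < q := by exact_mod_cast hq0
  set A := seqA X η q with hAq
  have h1 : ∑ Q ∈ normEq q, (siftedA X η Q z : ℝ) ≤ A.sifted (topA X η) (primesProdBelow z₂) :=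
    sum_normEq_siftedA_le_sifted_seqA hX.le hz₂z hsq
  have hsize : 0 ≤ A.size (topA X η) := by
    change 0 ≤ sizeA X η * densA q
    exact mul_nonneg (sizeA_nonneg X η) (densA_nonneg q)
  have h2 := SieveSequence.sifted_le_of_dvd_primesProdBelow (A := A) hdim
    (by norm_num : (0 : ℝ) < 3) (x := topA X η) hz₂2 hz₁1 hzD hsize
    (dvd_refl (primesProdBelow z₂))
  rw [hexp1, mul_one] at h2
  -- main term
  have hK : 0 ≤ 1 + 2 * K₃ ^ 10 := by have := hdim.one_le; positivity
  have hmain : (1 + 2 * K₃ ^ 10) * (A.size (topA X η) * A.densityProduct (primesProdBelow z₂)) ≤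
      (1 + 2 * K₃ ^ 10) * (6 / Real.pi ^ 2) * Kv * 28 * (η ^ 2 * X ^ 2 / Real.log z₁) *
        ((#(normEq q) : ℝ) / q) := by
    change (1 + 2 * K₃ ^ 10) * (sizeA X η * densA q * A.densityProduct (primesProdBelow z₂)) ≤ _
    rw [hAq, seqA_densityProduct]
    have hV0 : 0 ≤ ∏ p ∈ Nat.primesBelow ⌈z₂⌉₊, (1 - densA p) :=
      prod_nonneg fun p hp => (densA_prime_bounds (Nat.prime_of_mem_primesBelow hp)).1
    have hV : ∏ p ∈ Nat.primesBelow ⌈z₂⌉₊, (1 - densA p) ≤ Kv / Real.log z₂ := hKv z₂ hz₂2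
    have hdq := densA_le_card_normEq_div hsq
    have hd0 := densA_nonneg q
    have hs := sizeA_nonneg X η
    have hL₁ne : Real.log z₁ ≠ 0 := hL₁.ne'
    have hqne : (q : ℝ) ≠ 0 := hq0'.ne'
    calc (1 + 2 * K₃ ^ 10) * (sizeA X η * densA q * ∏ p ∈ Nat.primesBelow ⌈z₂⌉₊, (1 - densA p))
        ≤ (1 + 2 * K₃ ^ 10) * (sizeA X η * ((#(normEq q) : ℝ) / q) * (Kv / Real.log z₂)) := by
          gcongr
      _ = (1 + 2 * K₃ ^ 10) * (6 / Real.pi ^ 2) * Kv * 28 * (η ^ 2 * X ^ 2 / Real.log z₁) *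
            ((#(normEq q) : ℝ) / q) := by
          rw [hlogz₂, sizeA]
          field_simp
  -- remainders
  have hrem : ∑ d ∈ (primesProdBelow z₂).divisors.filter (fun d : ℕ => (d : ℝ) ≤ z₁),
      |A.remainder d (topA X η)| ≤
      ∑ d ∈ (primesProdBelow z₂).divisors.filter (fun d : ℕ => (d : ℝ) ≤ z₁),
        ∑ R ∈ normEq (q * d), |(countA X η R : ℝ) - sizeA X η * rho₂ R / Ideal.absNorm R| := by
    refine sum_le_sum fun d hd => ?_
    rw [mem_filter] at hd
    have hdP := Nat.dvd_of_mem_divisors hd.1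
    have hdsq : Squarefree d := Squarefree.squarefree_of_dvd hdP (squarefree_primesProdBelow z₂)
    have hqd : Squarefree (q * d) :=
      (Nat.squarefree_mul (hcop.coprime_dvd_right hdP)).mpr ⟨hsq, hdsq⟩
    exact abs_remainder_seqA_le hX.le η hqd
  calc ∑ Q ∈ normEq q, (siftedA X η Q z : ℝ) ≤ A.sifted (topA X η) (primesProdBelow z₂) := h1
    _ ≤ _ := h2
    _ ≤ _ := add_le_add hmain hrem

/-- **Collecting the remainders**: for `q ∈ 𝒬₁` (square-free, `≤ 2N`, coprime to `P(z₂)`) and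
`d ∣ P(z₂)`, `d ≤ z₁ ≤ X^{2−τ}/N`, the ideals of norm `qd` are distinct for distinct `(q, d)`, have
square-free norm `≤ B = 2X^{2−τ}`; those of norm `≥ 2` form the dyadic range of
`exists_typeI_dyadic` and the only other one is `⊤`. [folklore] -/
theorem remainder_collection_le {X η τ N z₁ z₂ : ℝ} (hX : 0 < X) (hN : 0 < N)
    (hz₁le : z₁ ≤ X ^ (2 - τ) / N) {𝒬₁ : Finset ℕ}
    (h𝒬₁ : ∀ q ∈ 𝒬₁, Squarefree q ∧ (q : ℝ) ≤ 2 * N ∧ q.Coprime (primesProdBelow z₂)) :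
    ∑ q ∈ 𝒬₁, ∑ d ∈ (primesProdBelow z₂).divisors.filter (fun d : ℕ => (d : ℝ) ≤ z₁),
        ∑ R ∈ normEq (q * d), |(countA X η R : ℝ) - sizeA X η * rho₂ R / Ideal.absNorm R| ≤
      |(#(boxPairs X η) : ℝ) - sizeA X η| +
        ∑ R ∈ (idealsLE ⌊2 * X ^ (2 - τ)⌋₊).filter
            (fun R => 2 ≤ Ideal.absNorm R ∧ Squarefree (Ideal.absNorm R)),
          |(countA X η R : ℝ) - sizeA X η * rho₂ R / Ideal.absNorm R| := by
  classical
  set B : ℝ := 2 * X ^ (2 - τ) with hB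
  set E : Ideal (𝓞 K) → ℝ := fun R => |(countA X η R : ℝ) - sizeA X η * rho₂ R / Ideal.absNorm R|
    with hE
  set Dset := (primesProdBelow z₂).divisors.filter (fun d : ℕ => (d : ℝ) ≤ z₁) with hDset
  set T : Finset (Ideal (𝓞 K)) := (idealsLE ⌊B⌋₊).filter (fun R => Squarefree (Ideal.absNorm R))
    with hT
  have h2N : 0 ≤ 2 * N := by linarith
  have hNne : N ≠ 0 := hN.ne'
  have hremle : ∑ q ∈ 𝒬₁, ∑ d ∈ Dset, ∑ R ∈ normEq (q * d), E R ≤ ∑ R ∈ T, E R := by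
    refine sum_sum_normEq_le (P := primesProdBelow z₂) (fun d hd => ?_) (fun d hd => ?_)
      (fun q hq => (h𝒬₁ q hq).2.2) (fun R => abs_nonneg _) T (fun q hq d hd => ?_)
    · rw [hDset, mem_filter] at hd; exact Nat.dvd_of_mem_divisors hd.1
    · rw [hDset, mem_filter] at hd; exact Nat.ne_of_gt (Nat.pos_of_mem_divisors hd.1)
    · intro R hR
      rw [mem_normEq] at hR
      obtain ⟨hsq, hq2, hcop⟩ := h𝒬₁ q hq
      rw [hDset, mem_filter] at hd
      have hdP := Nat.dvd_of_mem_divisors hd.1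
      have hdsq : Squarefree d := Squarefree.squarefree_of_dvd hdP (squarefree_primesProdBelow z₂)
      rw [hT, mem_filter, mem_idealsLE, hR]
      refine ⟨Nat.le_floor ?_, (Nat.squarefree_mul (hcop.coprime_dvd_right hdP)).mpr ⟨hsq, hdsq⟩⟩
      push_cast
      calc (q : ℝ) * d ≤ (2 * N) * z₁ := mul_le_mul hq2 hd.2 (Nat.cast_nonneg d) h2N
        _ ≤ (2 * N) * (X ^ (2 - τ) / N) := by gcongr
        _ = B := by rw [hB]; field_simp
  have hTsplit : ∑ R ∈ T, E R ≤ E ⊤ +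
      ∑ R ∈ (idealsLE ⌊B⌋₊).filter (fun R => 2 ≤ Ideal.absNorm R ∧ Squarefree (Ideal.absNorm R)), E R := by
    rw [← sum_filter_add_sum_filter_not T (fun R => 2 ≤ Ideal.absNorm R), add_comm]
    refine add_le_add ?_ (le_of_eq ?_)
    · have hsub : T.filter (fun R => ¬ 2 ≤ Ideal.absNorm R) ⊆ {⊤} := by
        intro R hR
        rw [mem_filter, hT, mem_filter] at hR
        obtain ⟨⟨-, hsq⟩, hlt⟩ := hR
        have h1 : Ideal.absNorm R = 1 := by
          have h0 : Ideal.absNorm R ≠ 0 := fun h => not_squarefree_zero (h ▸ hsq)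
          omega
        rw [mem_singleton]
        exact Ideal.absNorm_eq_one_iff.mp h1
      calc ∑ R ∈ T.filter (fun R => ¬ 2 ≤ Ideal.absNorm R), E R ≤ ∑ R ∈ {⊤}, E R :=
            sum_le_sum_of_subset_of_nonneg hsub fun R _ _ => abs_nonneg _
        _ = E ⊤ := sum_singleton _ _
    · rw [hT, filter_filter]
      exact sum_congr (filter_congr fun R _ => and_comm) fun _ _ => rfl
  have hEtop : E ⊤ = |(#(boxPairs X η) : ℝ) - sizeA X η| := by
    rw [hE]; simp only [countA_top_sub_eq]
  rw [← hEtop]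
  exact hremle.trans hTsplit

/-- **Absorption of the remainders by `X^{2−τ/5}`**: with the eventual inequalities of
`eventually_upperBound_params` (for `A₀ = 16C_T + 1`, `k + 1`) and `eventually_log_le_sqrt`,
`C_b X(1 + log X) + C_T(B + X√B + X^{3/2})(log X)^{k+1} ≤ X^{2−τ/5}` for `B = 2X^{2−τ}`
(`0 < τ ≤ 1/8`). [folklore] -/
theorem remainders_absorb_le {X τ C_T C_b : ℝ} {k : ℕ} (hX16 : 16 ≤ X) (hτ0 : 0 < τ)
    (hτ8 : τ ≤ 1 / 8) (hCT0 : 0 ≤ C_T)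
    (hsqrt : 2 * C_b * (1 + Real.log X) ≤ X ^ (1 / 2 : ℝ))
    (habs : (16 * C_T + 1) * X ^ (-τ / 5) * Real.log X ^ (k + 1) ≤
      τ * Real.exp (-2 * Real.log X ^ (1 / 3 : ℝ)) / Real.log X) :
    C_b * X * (1 + Real.log X) +
        C_T * (2 * X ^ (2 - τ) + X * Real.sqrt (2 * X ^ (2 - τ)) + X ^ (3 / 2 : ℝ)) *
          Real.log X ^ (k + 1) ≤ X ^ (2 - τ / 5) := by
  have hX1 : 1 < X := by linarith
  have hX0 : 0 < X := by linarith
  have hlogX : 0 < Real.log X := Real.log_pos hX1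
  have hlogX1 : 1 ≤ Real.log X := by
    rw [← Real.log_exp 1]
    refine Real.log_le_log (Real.exp_pos 1) ?_
    have := Real.exp_one_lt_d9
    linarith
  have hτ0' : 0 ≤ τ := hτ0.le
  set A₀ : ℝ := 16 * C_T + 1 with hA₀
  have hA₀pos : 0 < A₀ := by positivity
  have hXpow0 : 0 ≤ X ^ (2 - τ / 5) := Real.rpow_nonneg hX0.le _
  have hX32le : X ^ (3 / 2 : ℝ) ≤ X ^ (2 - τ / 5) :=
    Real.rpow_le_rpow_of_exponent_le hX1.le (by linarith)
  -- `C_b X(1 + log X) ≤ X^{3/2}/2`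
  have hEtop : C_b * X * (1 + Real.log X) ≤ X ^ (2 - τ / 5) / 2 := by
    calc C_b * X * (1 + Real.log X) = X * (2 * C_b * (1 + Real.log X)) / 2 := by ring
      _ ≤ X * X ^ (1 / 2 : ℝ) / 2 := by gcongr
      _ = X ^ (3 / 2 : ℝ) / 2 := by
          rw [show X * X ^ (1 / 2 : ℝ) = X ^ (1 : ℝ) * X ^ (1 / 2 : ℝ) by rw [Real.rpow_one],
            ← Real.rpow_add hX0]; norm_num
      _ ≤ X ^ (2 - τ / 5) / 2 := by linarith
  -- the dyadic Type I part `≤ X^{2−τ/5}/2`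
  have hgeom : 2 * X ^ (2 - τ) + X * Real.sqrt (2 * X ^ (2 - τ)) + X ^ (3 / 2 : ℝ) ≤
      5 * X ^ (2 - τ / 2) := by
    have h1 : X ^ (2 - τ) ≤ X ^ (2 - τ / 2) := Real.rpow_le_rpow_of_exponent_le hX1.le (by linarith)
    have h2 : Real.sqrt (2 * X ^ (2 - τ)) = Real.sqrt 2 * X ^ (1 - τ / 2) := by
      rw [Real.sqrt_mul (by norm_num), Real.sqrt_eq_rpow (X ^ (2 - τ)), ← Real.rpow_mul hX0.le,
        show (2 - τ) * (1 / 2 : ℝ) = 1 - τ / 2 by ring]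
    have h3 : X * X ^ (1 - τ / 2) = X ^ (2 - τ / 2) := by
      rw [show X * X ^ (1 - τ / 2) = X ^ (1 : ℝ) * X ^ (1 - τ / 2) by rw [Real.rpow_one],
        ← Real.rpow_add hX0]; ring_nf
    have h4 : X ^ (3 / 2 : ℝ) ≤ X ^ (2 - τ / 2) := Real.rpow_le_rpow_of_exponent_le hX1.le (by linarith)
    have hs2 : Real.sqrt 2 ≤ 2 := by
      rw [show (2 : ℝ) = Real.sqrt 4 by
        rw [show (4 : ℝ) = 2 ^ 2 by norm_num, Real.sqrt_sq (by norm_num)]]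
      exact Real.sqrt_le_sqrt (by norm_num)
    have hpos : 0 ≤ X ^ (2 - τ / 2) := Real.rpow_nonneg hX0.le _
    rw [h2, show X * (Real.sqrt 2 * X ^ (1 - τ / 2)) = Real.sqrt 2 * (X * X ^ (1 - τ / 2)) by ring, h3]
    nlinarith [Real.sqrt_nonneg 2, mul_le_mul_of_nonneg_right hs2 hpos]
  have habs' : A₀ * X ^ (-τ / 5) * Real.log X ^ (k + 1) ≤ 1 / 8 := by
    refine habs.trans ?_
    have he : Real.exp (-2 * Real.log X ^ (1 / 3 : ℝ)) ≤ 1 := Real.exp_le_one_iff.mpr (by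
      have : 0 ≤ Real.log X ^ (1 / 3 : ℝ) := Real.rpow_nonneg hlogX.le _; linarith)
    calc τ * Real.exp (-2 * Real.log X ^ (1 / 3 : ℝ)) / Real.log X ≤ τ * 1 / 1 := by
          gcongr
      _ ≤ 1 / 8 := by linarith
  have hlogpow : Real.log X ^ (k + 1) ≤ X ^ (τ / 5) / (8 * A₀) := by
    rw [le_div_iff₀ (by positivity)]
    have h := mul_le_mul_of_nonneg_left habs' (Real.rpow_nonneg hX0.le (τ / 5))
    have hcancel : X ^ (τ / 5) * (A₀ * X ^ (-τ / 5) * Real.log X ^ (k + 1)) =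
        A₀ * Real.log X ^ (k + 1) := by
      have : X ^ (τ / 5) * X ^ (-τ / 5) = 1 := by
        rw [← Real.rpow_add hX0, show τ / 5 + -τ / 5 = 0 by ring, Real.rpow_zero]
      calc X ^ (τ / 5) * (A₀ * X ^ (-τ / 5) * Real.log X ^ (k + 1))
          = (X ^ (τ / 5) * X ^ (-τ / 5)) * (A₀ * Real.log X ^ (k + 1)) := by ring
        _ = A₀ * Real.log X ^ (k + 1) := by rw [this, one_mul]
    rw [hcancel] at h
    linarith
  have hXexp : X ^ (2 - τ / 2) * X ^ (τ / 5) = X ^ (2 - 3 * τ / 10) := by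
    rw [← Real.rpow_add hX0]; ring_nf
  have hXle : X ^ (2 - 3 * τ / 10) ≤ X ^ (2 - τ / 5) :=
    Real.rpow_le_rpow_of_exponent_le hX1.le (by linarith)
  have hdyle : C_T * (2 * X ^ (2 - τ) + X * Real.sqrt (2 * X ^ (2 - τ)) + X ^ (3 / 2 : ℝ)) *
      Real.log X ^ (k + 1) ≤ X ^ (2 - τ / 5) / 2 := by
    calc C_T * (2 * X ^ (2 - τ) + X * Real.sqrt (2 * X ^ (2 - τ)) + X ^ (3 / 2 : ℝ)) *
          Real.log X ^ (k + 1)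
        ≤ C_T * (5 * X ^ (2 - τ / 2)) * (X ^ (τ / 5) / (8 * A₀)) :=
          mul_le_mul (mul_le_mul_of_nonneg_left hgeom hCT0) hlogpow (pow_nonneg hlogX.le _)
            (mul_nonneg hCT0 (by positivity))
      _ = (5 * C_T / (8 * A₀)) * (X ^ (2 - τ / 2) * X ^ (τ / 5)) := by ring
      _ ≤ (1 / 2) * X ^ (2 - 3 * τ / 10) := by
          rw [hXexp]
          refine mul_le_mul_of_nonneg_right ?_ (Real.rpow_nonneg hX0.le _)
          rw [div_le_iff₀ (by positivity), hA₀]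
          nlinarith
      _ ≤ X ^ (2 - τ / 5) / 2 := by linarith
  linarith

/-! ### Lemma 7.1 for `𝒜^(K)`, Lemma 7.1, and Lemma 3.6, from Lemma 3.2 -/

/-- **Heath-Brown's Lemma 7.1 for `𝒜^(K)` from Lemma 3.2** (the first display of Lemma 7.1, p. 39, in
the corrected ideal-weighted form of `HeathBrown2001_lemma_7_1_normWeighted`): assuming the Type I
bound `HeathBrown2001_typeI_A` (Lemma 3.2), for `0 < ϖ ≤ 1` there are `C, X₀` with
`∑_{N(Q)∈𝒬} S_K(𝒜^(K)_Q, z) ≤ C (η²X²/log min(z, X^{2−τ}/N) · ∑_{N(Q)∈𝒬} N(Q)^{-1} + X^{2−τ/5})` for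
`X ≥ X₀`, `η` in the range (2.1), `τ = (log log X)^{−ϖ}`, `z ≥ X^τ`, `0 < N ≤ X^{2−2τ}`, `𝒬` a
finite set of square-free integers in `(N, 2N]`.
Proof (pp. 40–41, the beta-sieve of the tree replacing Selberg's): group the `Q` by `q = N(Q)`
(`∑_{N(Q)∈𝒬} = ∑_{q∈𝒬} ∑_{N(Q)=q}`, and `∑_{N(Q)∈𝒬} N(Q)^{-1} = ∑_{q∈𝒬} c_K(q)/q`); if `q` has a prime
factor `< z₂ = z₁^{1/28}`, `z₁ = min(z, X^{2−τ}/N) ≥ X^τ ≥ e^{20}`, all `S_K(𝒜^(K)_Q, z)` vanish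
(`siftedA_eq_zero_of_prime_dvd`); otherwise `sum_normEq_siftedA_le_main_add_err` bounds the `q`-term by
the main term with the ideal weight `c_K(q)/q ≥ ρ₀(q)/q` and Type I remainders at the ideals of norm
`qd`, collected over `(q, d)` without repetition into `|#𝒜^(K) − X_𝒜| + ∑_{2 ≤ N(R) ≤ 2X^{2−τ}} |…|`
(`remainder_collection_le`), which is `≪ X log X + X^{2−τ/2}(log X)^{k+1} ≤ X^{2−τ/5}`
(`exists_abs_countA_one_sub_sizeA_le` of `HeathBrownCubicFLRemaindersA`, `exists_typeI_dyadic`,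
`remainders_absorb_le`).
[cite: HeathBrownActa2001, Lemma 7.1] -/
theorem HeathBrown2001_lemma_7_1_A_of_typeI_A (hA : HeathBrown2001_typeI_A) {ϖ : ℝ} (hϖ0 : 0 < ϖ)
    (hϖ1 : ϖ ≤ 1) :
    ∃ C X₀ : ℝ, ∀ X η : ℝ, X₀ ≤ X → Real.exp (-Real.log X ^ (1 / 3 : ℝ)) ≤ η → η ≤ 1 →
      ∀ (N z : ℝ) (𝒬 : Finset ℕ), X ^ hbTau ϖ X ≤ z → 0 < N → N ≤ X ^ (2 - 2 * hbTau ϖ X) →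
        (∀ q ∈ 𝒬, Squarefree q ∧ N < q ∧ (q : ℝ) ≤ 2 * N) →
        (∑ Q ∈ normIn 𝒬, (siftedA X η Q z : ℝ)) ≤
            C * (η ^ 2 * X ^ 2 / Real.log (min z (X ^ (2 - hbTau ϖ X) / N)) *
                  ∑ Q ∈ normIn 𝒬, ((Ideal.absNorm Q : ℕ) : ℝ)⁻¹ + X ^ (2 - hbTau ϖ X / 5)) := by
  classical
  obtain ⟨Kv, hKv0, hKv⟩ := exists_prod_one_sub_densA_le
  obtain ⟨k, C_T, hCT0, hCT⟩ := exists_typeI_dyadic hA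
  obtain ⟨C_b, hCb0, hCb⟩ := exists_abs_countA_one_sub_sizeA_le
  obtain ⟨K₃, hK₃⟩ : ∃ K₃ : ℝ, K₃ = dimConst := ⟨_, rfl⟩
  have hdim : HasSieveDimension densA 3 K₃ := hK₃ ▸ hasSieveDimension_densA
  set C₁ : ℝ := (1 + 2 * K₃ ^ 10) * (6 / Real.pi ^ 2) * Kv * 28 with hC₁
  have hA₀pos : 0 < 16 * C_T + 1 := by positivity
  obtain ⟨X₀, hX₀⟩ := Filter.eventually_atTop.mp
    ((eventually_params_B 1 hϖ0 hϖ1).and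
      ((eventually_upperBound_params hϖ0 hϖ1 hA₀pos (k + 1)).and
        (eventually_log_le_sqrt (by positivity : (0 : ℝ) < 2 * C_b))))
  refine ⟨max C₁ 1, X₀, fun X η hX hηlo hη1 N z 𝒬 hz hN hN2 h𝒬 => ?_⟩
  obtain ⟨⟨hX16, hτ0, hτ8, hτL, -⟩, ⟨-, -, -, -, habs⟩, hsqrt⟩ := hX₀ X hX
  set τ := hbTau ϖ X with hτdef
  have hX1 : 1 < X := by linarith
  have hX0 : 0 < X := by linarith
  have hX3 : 3 ≤ X := by linarith
  have hη0 : 0 < η := lt_of_lt_of_le (Real.exp_pos _) hηlo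
  -- `z₁ = min z (X^{2−τ}/N) ≥ X^τ ≥ e^{20}`
  set z₁ := min z (X ^ (2 - τ) / N) with hz₁
  have hz₁ge : X ^ τ ≤ z₁ := by
    refine le_min hz ?_
    rw [le_div_iff₀ hN]
    calc X ^ τ * N ≤ X ^ τ * X ^ (2 - 2 * τ) := by gcongr
      _ = X ^ (2 - τ) := by rw [← Real.rpow_add hX0]; ring_nf
  have hz₁20 : Real.exp 20 ≤ z₁ := by
    have hXτ : X ^ τ = Real.exp (τ * Real.log X) := by
      rw [Real.rpow_def_of_pos hX0, mul_comm]
    rw [hXτ] at hz₁ge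
    exact (Real.exp_le_exp.mpr hτL).trans hz₁ge
  have hz₁1 : 1 < z₁ := lt_of_lt_of_le (Real.one_lt_exp_iff.mpr (by norm_num)) hz₁20
  have hz₁0 : 0 < z₁ := by linarith
  have hL₁ : 0 < Real.log z₁ := Real.log_pos hz₁1
  have hz₁z : z₁ ≤ z := min_le_left _ _
  have hz₁le : z₁ ≤ X ^ (2 - τ) / N := min_le_right _ _
  set z₂ := z₁ ^ (1 / 28 : ℝ) with hz₂
  have hz₂z₁ : z₂ ≤ z₁ := by
    calc z₂ = z₁ ^ (1 / 28 : ℝ) := rfl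
      _ ≤ z₁ ^ (1 : ℝ) := Real.rpow_le_rpow_of_exponent_le hz₁1.le (by norm_num)
      _ = z₁ := Real.rpow_one z₁
  have hz₂z : z₂ ≤ z := hz₂z₁.trans hz₁z
  -- grouping by the norm
  have hfib : ∀ f : Ideal (𝓞 K) → ℝ,
      ∑ Q ∈ normIn 𝒬, f Q = ∑ q ∈ 𝒬, ∑ Q ∈ normEq q, f Q := by
    intro f
    rw [← sum_fiberwise_of_maps_to (s := normIn 𝒬) (t := 𝒬) (g := fun Q => Ideal.absNorm Q)
      fun Q hQ => mem_normIn_iff.mp hQ]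
    refine sum_congr rfl fun q hq => sum_congr ?_ fun _ _ => rfl
    ext Q
    rw [mem_filter, mem_normIn_iff, mem_normEq]
    exact ⟨fun h => h.2, fun h => ⟨h ▸ hq, h⟩⟩
  have hweight : ∑ Q ∈ normIn 𝒬, ((Ideal.absNorm Q : ℕ) : ℝ)⁻¹ =
      ∑ q ∈ 𝒬, (#(normEq q) : ℝ) / q := by
    rw [hfib]
    refine sum_congr rfl fun q _ => ?_
    have hc : ∀ Q ∈ normEq q, ((Ideal.absNorm Q : ℕ) : ℝ)⁻¹ = ((q : ℕ) : ℝ)⁻¹ := fun Q hQ => by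
      rw [mem_normEq.mp hQ]
    rw [sum_congr rfl hc, sum_const, nsmul_eq_mul, div_eq_mul_inv]
  -- the `q` with a small prime factor contribute nothing
  set 𝒬₁ := 𝒬.filter (fun q => q.Coprime (primesProdBelow z₂)) with h𝒬₁
  have hvanish : ∀ q ∈ 𝒬, ¬ q.Coprime (primesProdBelow z₂) →
      ∑ Q ∈ normEq q, (siftedA X η Q z : ℝ) = 0 := by
    intro q hq hcop
    obtain ⟨p, hp, hpq, hpP⟩ := Nat.Prime.not_coprime_iff_dvd.mp hcop
    have hpz : (p : ℝ) < z := ((dvd_primesProdBelow_iff hp z₂).mp hpP).trans_le hz₂z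
    refine sum_eq_zero fun Q hQ => ?_
    rw [mem_normEq] at hQ
    rw [siftedA_eq_zero_of_prime_dvd (hQ ▸ (h𝒬 q hq).1) hp (hQ ▸ hpq) hpz, Nat.cast_zero]
  have hsplit : ∑ q ∈ 𝒬, ∑ Q ∈ normEq q, (siftedA X η Q z : ℝ) =
      ∑ q ∈ 𝒬₁, ∑ Q ∈ normEq q, (siftedA X η Q z : ℝ) := by
    rw [h𝒬₁, sum_filter]
    refine sum_congr rfl fun q hq => ?_
    split_ifs with hc
    · rfl
    · exact hvanish q hq hc
  have h𝒬₁ : ∀ q ∈ 𝒬₁, Squarefree q ∧ N < q ∧ (q : ℝ) ≤ 2 * N ∧ q.Coprime (primesProdBelow z₂) := by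
    intro q hq
    rw [h𝒬₁, mem_filter] at hq
    exact ⟨(h𝒬 q hq.1).1, (h𝒬 q hq.1).2.1, (h𝒬 q hq.1).2.2, hq.2⟩
  -- the bound for a single `q`, summed
  set Dset := (primesProdBelow z₂).divisors.filter (fun d : ℕ => (d : ℝ) ≤ z₁) with hDset
  set E : Ideal (𝓞 K) → ℝ := fun R => |(countA X η R : ℝ) - sizeA X η * rho₂ R / Ideal.absNorm R|
    with hE
  have hperq : ∀ q ∈ 𝒬₁, ∑ Q ∈ normEq q, (siftedA X η Q z : ℝ) ≤
      C₁ * (η ^ 2 * X ^ 2 / Real.log z₁) * ((#(normEq q) : ℝ) / q) +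
        ∑ d ∈ Dset, ∑ R ∈ normEq (q * d), E R := by
    intro q hq
    obtain ⟨hsq, hNq, -, hcop⟩ := h𝒬₁ q hq
    have hq0 : 0 < q := by exact_mod_cast hN.trans hNq
    exact sum_normEq_siftedA_le_main_add_err hKv hdim hX0 hz₁20 hz₁z hsq hq0 hcop
  have hsumq := sum_le_sum hperq
  rw [sum_add_distrib, ← mul_sum] at hsumq
  have hmainle : C₁ * (η ^ 2 * X ^ 2 / Real.log z₁) * ∑ q ∈ 𝒬₁, (#(normEq q) : ℝ) / q ≤
      C₁ * (η ^ 2 * X ^ 2 / Real.log z₁) * ∑ Q ∈ normIn 𝒬, ((Ideal.absNorm Q : ℕ) : ℝ)⁻¹ := by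
    rw [hweight]
    have hC₁0 : 0 ≤ C₁ := by
      rw [hC₁]; have := hdim.one_le; positivity
    refine mul_le_mul_of_nonneg_left ?_ (by positivity)
    exact sum_le_sum_of_subset_of_nonneg (filter_subset _ _) fun q _ _ => by positivity
  -- the remainders
  have hremle := remainder_collection_le (X := X) (η := η) (τ := τ) hX0 hN hz₁le
    (𝒬₁ := 𝒬₁) (z₂ := z₂) fun q hq => ⟨(h𝒬₁ q hq).1, (h𝒬₁ q hq).2.2.1, (h𝒬₁ q hq).2.2.2⟩
  have hB1 : 1 ≤ 2 * X ^ (2 - τ) := by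
    have : 1 ≤ X ^ (2 - τ) := Real.one_le_rpow hX1.le (by linarith)
    linarith
  have hBX : 2 * X ^ (2 - τ) ≤ X ^ 3 := by
    have hX2τ : X ^ (2 - τ) ≤ X ^ 2 := by
      rw [show X ^ 2 = X ^ (2 : ℝ) by norm_cast]
      exact Real.rpow_le_rpow_of_exponent_le hX1.le (by linarith)
    calc 2 * X ^ (2 - τ) ≤ 2 * X ^ 2 := by linarith
      _ ≤ X * X ^ 2 := by gcongr; linarith
      _ = X ^ 3 := by ring
  have hdy := hCT X η (2 * X ^ (2 - τ)) hX3 hηlo hη1 hB1 hBX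
  have hbox : |(#(boxPairs X η) : ℝ) - sizeA X η| ≤ C_b * X * (1 + Real.log X) := by
    have h := hCb X η (by linarith) hη0.le hη1
    rwa [countA, APairs_one] at h
  have habsorb := remainders_absorb_le hX16 hτ0 hτ8 hCT0 hsqrt habs
  have hXpow0 : 0 ≤ X ^ (2 - τ / 5) := Real.rpow_nonneg hX0.le _
  have hRHS0 : 0 ≤ η ^ 2 * X ^ 2 / Real.log z₁ * ∑ Q ∈ normIn 𝒬, ((Ideal.absNorm Q : ℕ) : ℝ)⁻¹ :=
    mul_nonneg (by positivity) (sum_nonneg fun Q _ => by positivity)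
  have hC₁le : C₁ ≤ max C₁ 1 := le_max_left _ _
  have h1le : (1 : ℝ) ≤ max C₁ 1 := le_max_right _ _
  calc ∑ Q ∈ normIn 𝒬, (siftedA X η Q z : ℝ)
      = ∑ q ∈ 𝒬₁, ∑ Q ∈ normEq q, (siftedA X η Q z : ℝ) := by rw [hfib, hsplit]
    _ ≤ C₁ * (η ^ 2 * X ^ 2 / Real.log z₁) * ∑ q ∈ 𝒬₁, (#(normEq q) : ℝ) / q +
          ∑ q ∈ 𝒬₁, ∑ d ∈ Dset, ∑ R ∈ normEq (q * d), E R := hsumq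
    _ ≤ C₁ * (η ^ 2 * X ^ 2 / Real.log z₁) * ∑ Q ∈ normIn 𝒬, ((Ideal.absNorm Q : ℕ) : ℝ)⁻¹ +
          (|(#(boxPairs X η) : ℝ) - sizeA X η| +
            ∑ R ∈ (idealsLE ⌊2 * X ^ (2 - τ)⌋₊).filter
                (fun R => 2 ≤ Ideal.absNorm R ∧ Squarefree (Ideal.absNorm R)), E R) :=
        add_le_add hmainle hremle
    _ ≤ C₁ * (η ^ 2 * X ^ 2 / Real.log z₁) * ∑ Q ∈ normIn 𝒬, ((Ideal.absNorm Q : ℕ) : ℝ)⁻¹ +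
          X ^ (2 - τ / 5) := by
        exact add_le_add le_rfl ((add_le_add hbox hdy).trans habsorb)
    _ ≤ max C₁ 1 * (η ^ 2 * X ^ 2 / Real.log z₁ * ∑ Q ∈ normIn 𝒬, ((Ideal.absNorm Q : ℕ) : ℝ)⁻¹) +
          max C₁ 1 * X ^ (2 - τ / 5) := by
        refine add_le_add ?_ (le_mul_of_one_le_left hXpow0 h1le)
        rw [mul_assoc]
        exact mul_le_mul_of_nonneg_right hC₁le hRHS0
    _ = max C₁ 1 * (η ^ 2 * X ^ 2 / Real.log z₁ * ∑ Q ∈ normIn 𝒬, ((Ideal.absNorm Q : ℕ) : ℝ)⁻¹ +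
          X ^ (2 - τ / 5)) := by ring

/-- **Heath-Brown's Lemma 7.1 (corrected, ideal-weighted form) from Lemma 3.2**: the named fact
`HeathBrown2001_lemma_7_1_normWeighted` follows from the Type I bound `HeathBrown2001_typeI_A`
(Lemma 3.2) alone — the `ℬ^(K)`-half being proved outright in `HeathBrownCubicNormWindowSieve`
(`HeathBrown2001_lemma_7_1_B`) and the `𝒜^(K)`-half in `HeathBrown2001_lemma_7_1_A_of_typeI_A`.
[cite: HeathBrownActa2001, Lemma 7.1] -/
theorem HeathBrown2001_lemma_7_1_normWeighted_of_typeI_A (hA : HeathBrown2001_typeI_A) :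
    HeathBrown2001_lemma_7_1_normWeighted := by
  intro ϖ hϖ0 hϖ5
  have hϖ1 : ϖ ≤ 1 := by linarith
  obtain ⟨C_A, X_A, hCA⟩ := HeathBrown2001_lemma_7_1_A_of_typeI_A hA hϖ0 hϖ1
  obtain ⟨C_B, X_B, hCB⟩ := HeathBrown2001_lemma_7_1_B hϖ0 hϖ1
  obtain ⟨X₁, hX₁⟩ := Filter.eventually_atTop.mp (eventually_params_B 1 hϖ0 hϖ1)
  refine ⟨max C_A C_B, max (max X_A X_B) X₁, fun X η hX hηlo hη1 N z 𝒬 hz hN hN2 h𝒬 => ?_⟩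
  have hXA : X_A ≤ X := (le_max_left _ _).trans ((le_max_left _ _).trans hX)
  have hXB : X_B ≤ X := (le_max_right _ _).trans ((le_max_left _ _).trans hX)
  have hX1' : X₁ ≤ X := (le_max_right _ _).trans hX
  obtain ⟨hX16, hτ0, -, -, -⟩ := hX₁ X hX1'
  have hX0 : 0 < X := by linarith
  have hX1 : 1 < X := by linarith
  have hz₁ : 1 < min z (X ^ (2 - hbTau ϖ X) / N) := by
    have hXτ : 1 < X ^ hbTau ϖ X := Real.one_lt_rpow hX1 hτ0
    refine lt_min (hXτ.trans_le hz) ?_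
    rw [lt_div_iff₀ hN, one_mul]
    calc N ≤ X ^ (2 - 2 * hbTau ϖ X) := hN2
      _ < X ^ (2 - hbTau ϖ X) := Real.rpow_lt_rpow_of_exponent_lt hX1 (by linarith)
  have hlog : 0 < Real.log (min z (X ^ (2 - hbTau ϖ X) / N)) := Real.log_pos hz₁
  have hS : 0 ≤ ∑ Q ∈ normIn 𝒬, ((Ideal.absNorm Q : ℕ) : ℝ)⁻¹ := sum_nonneg fun Q _ => by positivity
  have hη0 : 0 < η := lt_of_lt_of_le (Real.exp_pos _) hηlo
  have hbrA : 0 ≤ η ^ 2 * X ^ 2 / Real.log (min z (X ^ (2 - hbTau ϖ X) / N)) *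
      ∑ Q ∈ normIn 𝒬, ((Ideal.absNorm Q : ℕ) : ℝ)⁻¹ + X ^ (2 - hbTau ϖ X / 5) :=
    add_nonneg (mul_nonneg (by positivity) hS) (Real.rpow_nonneg hX0.le _)
  have hbrB : 0 ≤ η * X ^ 3 / Real.log (min z (X ^ (2 - hbTau ϖ X) / N)) *
      ∑ Q ∈ normIn 𝒬, ((Ideal.absNorm Q : ℕ) : ℝ)⁻¹ + X ^ (3 - hbTau ϖ X / 5) :=
    add_nonneg (mul_nonneg (by positivity) hS) (Real.rpow_nonneg hX0.le _)
  constructor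
  · exact (hCA X η hXA hηlo hη1 N z 𝒬 hz hN hN2 h𝒬).trans
      (mul_le_mul_of_nonneg_right (le_max_left _ _) hbrA)
  · exact (hCB X η hXB hηlo hη1 N z 𝒬 hz hN hN2 h𝒬).trans
      (mul_le_mul_of_nonneg_right (le_max_right _ _) hbrB)

/-- **Heath-Brown's Lemma 3.6 from Lemma 3.2**: `HeathBrown2001_lemma_3_6` follows from the Type I
bound `HeathBrown2001_typeI_A` (through Lemma 7.1, `HeathBrown2001_lemma_7_1_normWeighted_of_typeI_A`,
and the tree's `HeathBrown2001_lemma_3_6_of_lemma_7_1`). Once Lemma 3.2 is proved in the tree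
(`HeathBrown2001_typeI_A_holds`), `HeathBrown2001_lemma_3_6_holds` is this theorem applied to it.
[cite: HeathBrownActa2001, Lemma 3.6] -/
theorem HeathBrown2001_lemma_3_6_of_typeI_A (hA : HeathBrown2001_typeI_A) : HeathBrown2001_lemma_3_6 :=
  HeathBrown2001_lemma_3_6_of_lemma_7_1 (HeathBrown2001_lemma_7_1_normWeighted_of_typeI_A hA)

end Literature.NumberTheory.Sieve.CubicSieve
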